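import Summits.HodgeConjecture.HodgeConjecture.Theorems.VHCAbelianSchemesRoadDiagonalCM
import Summits.HodgeConjecture.HodgeConjecture.Theorems.VHCAbelianSchemesRoadDegreeConfinementItems
import HarnessLib

/-!
# Road b02 (`VHCAbelianSchemesRoad`, D-0059) — the DIAGONAL confinement stated ON THE ROUTE DECLS: the road's leaf `HC_AV` from the
# items of `closes` with the crux `SemiregularSheafRepresentativesTwAt` (item 19274) replaced by its diagonal slice

research route conditional on HC_CM; not a corollary; Q11.4-sentence-2 already refuted in dim ≥ 3.
(cell line of seat ab-andre-2: research route, not a corollary; conditional on HC_CM plus one named minimal statement.)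

THEOREMS ONLY (no definition, no named fact, no sorry; nothing of the road's research content is claimed; `HC_CM` is an explicit
HYPOTHESIS of §3, the route decl `Theses.RankFourFaces.CMAbelianHodge`). Seat ab-andre-2 gen 55, PART X-c: the companion files
`VHCAbelianSchemesRoadDiagonal.lean` (p448719) / `…DiagonalCM.lean` (p449674) prove the confinement over the carrier's constants; this
file imports the ROUTE FILE and restates it with the hypotheses LITERALLY the route decls of `Theses.VHCAbelianSchemesRoad` (and the
admissibility notion AdmTw spelled out), so that a route edit replacing item 19274 by a diagonal slice is a one-term `closes`:
* §1 `twAtDiag_of_semiregularSheafRepresentativesTwAt` — the diagonal slice IS IMPLIED by the crux as filed (C → S bookkeeping: the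
  slice is a WEAKER hypothesis; cells `(2m, m)` only);
* §2 `hc_av_of_twAtDiag_two` — `HC_AV` from `ChernCharacterOnBetti`, the slice `m ≥ 2`, `TwistedPerfectDoor`, `RaynaudSectionProjective`,
  `AndreCMAnchoredPencil`, `AndreAnchoredPencilsAlgebraic` (the six binders of `closes` with the crux sliced; FACT-FREE); and
  `hc_av_of_hodgeAbelianDimLeFive_of_twAtDiag_three` — the slice from `(6, 3)` on, granted the support item
  `Theses.SevenfoldWeilCensus.HodgeAbelianDimLeFive` (stmt-HodgeConjecture-18723; Markman 2025 Cor. 1.3, UNREFEREED);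
* §3 the `HC_CM`-load-bearing chains: `hc_av_of_cmAbelianHodge_of_twAtDiag_four` (NO `AndreAnchoredPencilsAlgebraic`: Lemme 6.3.1 and
  `HC_CM` instead of Lemmes 6.3.2–6.3.3; slice `m ≥ 4`, fact-free) and `…_of_hodgeAbelianDimLeFive_…_six` (slice `m ≥ 6`);
* §4 `assembly_of_diag` — the filed `Assembly` re-derived THROUGH the diagonal (the sliced chain subsumes the filed one).

References: [Andre1996Motifs] §6.3; [BrosnanFangNiePearlstein2009] §6 Lemma 48; [Lieberman1968]; [Markman2025SurveySecant] Cor. 1.3;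
[Pridham2024Semiregularity] Cor. 2.25, Rem. 2.27; [GortzWedhorn2023] Thm. 27.291; [BuchweitzFlenner2003] §5 Thm. 5.1; [Milne1999] §7.
-/

noncomputable section

open CategoryTheory CategoryTheory.Limits AlgebraicGeometry Topology

namespace Summit.HodgeConjecture.HodgeConjecture.Ring2.SemiregularRepresentatives

set_option linter.dupNamespace false -- the cell's namespace repeats the summit name, as in every `Ring2*` file

open Literature.AlgebraicGeometry Literature.AlgebraicGeometry.Motives Literature.AlgebraicGeometry.HodgeTheory
open Literature.AlgebraicTopology.SingularHomology
open Summit.Ventures.HSemireg (ObjClass)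
open Summit.HodgeConjecture.HodgeConjecture.Ring2.Binders
open Summit.HodgeConjecture.HodgeConjecture.Ring2.ClassTargets

/-- The road's admissibility notion AdmTw contains Buchweitz–Flenner's single-bundle notion (`Or.inr`). [folklore] -/
private theorem admTw_of_bfSingle :
    ∀ n X₀ I E, bfSingleAdmissible n X₀ I E →
      (fun n X₀ I E => Summit.Ventures.HSemireg.gluableSigmaAdmissible n X₀ I E ∨
        Literature.AlgebraicGeometry.HodgeTheory.bfSingleAdmissible n X₀ I E) n X₀ I E :=
  fun _ _ _ _ h => Or.inr h

/-! ## §1 The diagonal slice is implied by the crux as filed -/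

/-- **Item 19274 ⟹ its diagonal slice**: `SemiregularSheafRepresentativesTwAt` gives regime 2 at every diagonal cell `(2m, m)` for the
twisted door, every `C` (the crux is the conjunction of its `(n, p)` slices, part W). [cite: Bloch1972Semiregularity, Remark (7.5)]
[cite: vanGeemen1994HodgeAV, §2.4] -/
theorem twAtDiag_of_semiregularSheafRepresentativesTwAt (h : Theses.VHCAbelianSchemesRoad.SemiregularSheafRepresentativesTwAt)
    (C : ChernCharacterBetti) (m : ℕ) :
    LefAtExceptionalRegimeAt (Literature.AlgebraicGeometry.HodgeTheory.twistedReflexiveClass C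
      (fun n X₀ I E => Summit.Ventures.HSemireg.gluableSigmaAdmissible n X₀ I E ∨
        Literature.AlgebraicGeometry.HodgeTheory.bfSingleAdmissible n X₀ I E)) (2 * m) m :=
  lefAtExceptionalRegimeAt_of_admissibleRepresentativesLefAtDeg (admissibleRepresentativesLefAt_iff_forall_deg.1 (h C) (2 * m) m)

/-! ## §2 `HC_AV` from the binders of `closes` with the crux SLICED to its diagonal -/

/-- **`HC_AV` from the six binders of `Theses.VHCAbelianSchemesRoad.closes` with `SemiregularSheafRepresentativesTwAt` replaced by its
diagonal slice `m ≥ 2`** — FACT-FREE beyond the displayed route decls (K-C, twisted door, Raynaud, André #21/#22). First cell `(4, 2)`.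
[cite: Andre1996Motifs, §6.3 Lemmes 6.3.1–6.3.3] [cite: BrosnanFangNiePearlstein2009, §6 Lemma 48] [cite: Pridham2024Semiregularity, Cor. 2.25 and Rem. 2.27]
[cite: GortzWedhorn2023, Thm. 27.291] -/
theorem hc_av_of_twAtDiag_two (hC : Theses.VHCAbelianSchemesRoad.ChernCharacterOnBetti)
    (hDiag : ∀ (C : ChernCharacterBetti) (m : ℕ), 2 ≤ m →
      LefAtExceptionalRegimeAt (Literature.AlgebraicGeometry.HodgeTheory.twistedReflexiveClass C
        (fun n X₀ I E => Summit.Ventures.HSemireg.gluableSigmaAdmissible n X₀ I E ∨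
          Literature.AlgebraicGeometry.HodgeTheory.bfSingleAdmissible n X₀ I E)) (2 * m) m)
    (hDoor : Theses.VHCAbelianSchemesRoad.TwistedPerfectDoor) (hR : Theses.VHCAbelianSchemesRoad.RaynaudSectionProjective)
    (h₂₁ : Theses.VHCAbelianSchemesRoad.AndreCMAnchoredPencil) (h₂₂ : Theses.VHCAbelianSchemesRoad.AndreAnchoredPencilsAlgebraic) :
    Theses.PadicSemiregularLift.HodgeAbelianVarieties :=
  hc_av_of_exceptionalRegimeAt_twisted_diagonal_two hC admTw_of_bfSingle hDiag hDoor hR h₂₁ h₂₂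

/-- **`HC_AV` from the binders of `closes` with the crux replaced by its diagonal slice FROM `(6, 3)` ON, granted the support item
`Theses.SevenfoldWeilCensus.HodgeAbelianDimLeFive`** (stmt-HodgeConjecture-18723 = Markman 2025 Cor. 1.3, UNREFEREED). Of the `(n, p)`-table
of regime 2 only `(6,3), (8,4), (10,5), …` is consumed. [cite: Andre1996Motifs, §6.3 Lemmes 6.3.1–6.3.3] [cite: Markman2025SurveySecant, Cor. 1.3]
[cite: BrosnanFangNiePearlstein2009, §6 Lemma 48] [cite: Pridham2024Semiregularity, Cor. 2.25 and Rem. 2.27] -/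
theorem hc_av_of_hodgeAbelianDimLeFive_of_twAtDiag_three (hC : Theses.VHCAbelianSchemesRoad.ChernCharacterOnBetti)
    (h₅ : Theses.SevenfoldWeilCensus.HodgeAbelianDimLeFive)
    (hDiag : ∀ (C : ChernCharacterBetti) (m : ℕ), 3 ≤ m →
      LefAtExceptionalRegimeAt (Literature.AlgebraicGeometry.HodgeTheory.twistedReflexiveClass C
        (fun n X₀ I E => Summit.Ventures.HSemireg.gluableSigmaAdmissible n X₀ I E ∨
          Literature.AlgebraicGeometry.HodgeTheory.bfSingleAdmissible n X₀ I E)) (2 * m) m)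
    (hDoor : Theses.VHCAbelianSchemesRoad.TwistedPerfectDoor) (hR : Theses.VHCAbelianSchemesRoad.RaynaudSectionProjective)
    (h₂₁ : Theses.VHCAbelianSchemesRoad.AndreCMAnchoredPencil) (h₂₂ : Theses.VHCAbelianSchemesRoad.AndreAnchoredPencilsAlgebraic) :
    Theses.PadicSemiregularLift.HodgeAbelianVarieties :=
  hc_av_of_hcUpToDim_five_of_exceptionalRegimeAt_twisted_diagonal_three hC admTw_of_bfSingle
    (hcUpToDim_five_iff_hodgeAbelianDimLeFive.2 h₅) hDiag hDoor hR h₂₁ h₂₂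

/-! ## §3 The `HC_CM`-load-bearing chains (Lemme 6.3.1 + `HC_CM`; NO `AndreAnchoredPencilsAlgebraic`) -/

/-- **`HC_AV` from K-C, `HC_CM` (`Theses.RankFourFaces.CMAbelianHodge`), the diagonal slice `m ≥ 4`, the twisted door, Raynaud and Lemme
6.3.1** — fact-free beyond the displayed decls; Lemmes 6.3.2–6.3.3 are NOT used. [cite: Andre1996Motifs, Lemme 6.3.1 (p. 31) and §6.3 a) (p. 33)]
[cite: Abdulali1994FamiliesAV, Lemma 6.2 (p. 1131)] [cite: Pridham2024Semiregularity, Cor. 2.25 and Rem. 2.27] [cite: GortzWedhorn2023, Thm. 27.291] -/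
theorem hc_av_of_cmAbelianHodge_of_twAtDiag_four (hC : Theses.VHCAbelianSchemesRoad.ChernCharacterOnBetti)
    (hCM : Theses.RankFourFaces.CMAbelianHodge)
    (hDiag : ∀ (C : ChernCharacterBetti) (m : ℕ), 4 ≤ m →
      LefAtExceptionalRegimeAt (Literature.AlgebraicGeometry.HodgeTheory.twistedReflexiveClass C
        (fun n X₀ I E => Summit.Ventures.HSemireg.gluableSigmaAdmissible n X₀ I E ∨
          Literature.AlgebraicGeometry.HodgeTheory.bfSingleAdmissible n X₀ I E)) (2 * m) m)
    (hDoor : Theses.VHCAbelianSchemesRoad.TwistedPerfectDoor) (hR : Theses.VHCAbelianSchemesRoad.RaynaudSectionProjective)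
    (h₂₁ : Theses.VHCAbelianSchemesRoad.AndreCMAnchoredPencil) : Theses.PadicSemiregularLift.HodgeAbelianVarieties :=
  hc_av_of_HC_CM_of_exceptionalRegimeAt_twisted_diagonal_four hC admTw_of_bfSingle hCM hDiag hDoor hR h₂₁

/-- **`HC_AV` from K-C, `HC_CM`, the support item `HodgeAbelianDimLeFive`, the diagonal slice `m ≥ 6`, the twisted door, Raynaud and
Lemme 6.3.1.** In the cell's framing «conditional on HC_CM plus one named minimal statement» the minimal statement of road b02 reads:
K-C ∧ TwistedPerfectDoor ∧ «regime 2 over the twisted door on the diagonal cells `(2m, m)`, `m ≥ 6`» (mod Markman ≤ 5, Raynaud, Lemme 6.3.1).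
[cite: Andre1996Motifs, Lemme 6.3.1 (p. 31) and §6.3 a) (p. 33)] [cite: Markman2025SurveySecant, Cor. 1.3] [cite: Abdulali1994FamiliesAV, Lemma 6.2 (p. 1131)]
[cite: Pridham2024Semiregularity, Cor. 2.25 and Rem. 2.27] -/
theorem hc_av_of_cmAbelianHodge_of_hodgeAbelianDimLeFive_of_twAtDiag_six (hC : Theses.VHCAbelianSchemesRoad.ChernCharacterOnBetti)
    (hCM : Theses.RankFourFaces.CMAbelianHodge) (h₅ : Theses.SevenfoldWeilCensus.HodgeAbelianDimLeFive)
    (hDiag : ∀ (C : ChernCharacterBetti) (m : ℕ), 6 ≤ m →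
      LefAtExceptionalRegimeAt (Literature.AlgebraicGeometry.HodgeTheory.twistedReflexiveClass C
        (fun n X₀ I E => Summit.Ventures.HSemireg.gluableSigmaAdmissible n X₀ I E ∨
          Literature.AlgebraicGeometry.HodgeTheory.bfSingleAdmissible n X₀ I E)) (2 * m) m)
    (hDoor : Theses.VHCAbelianSchemesRoad.TwistedPerfectDoor) (hR : Theses.VHCAbelianSchemesRoad.RaynaudSectionProjective)
    (h₂₁ : Theses.VHCAbelianSchemesRoad.AndreCMAnchoredPencil) : Theses.PadicSemiregularLift.HodgeAbelianVarieties :=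
  hc_av_of_HC_CM_of_hcUpToDim_five_of_exceptionalRegimeAt_twisted_diagonal_six hC admTw_of_bfSingle hCM
    (hcUpToDim_five_iff_hodgeAbelianDimLeFive.2 h₅) hDiag hDoor hR h₂₁

/-! ## §4 The filed `Assembly` through the diagonal -/

/-- **The filed chain subsumes into the sliced one**: `Theses.VHCAbelianSchemesRoad.Assembly` (item 19539, closed) re-derived by slicing
the crux to its diagonal (§1) and running §2's `m ≥ 2` chain — so a route whose crux is the slice closes the same leaf from weaker
hypotheses. [cite: Andre1996Motifs, §6.3 Lemmes 6.3.1–6.3.3] [cite: BrosnanFangNiePearlstein2009, §6 Lemma 48] -/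
theorem assembly_of_diag : Theses.VHCAbelianSchemesRoad.Assembly :=
  fun hC hTw hDoor hR h₂₁ h₂₂ =>
    hc_av_of_twAtDiag_two hC (fun C m _ => twAtDiag_of_semiregularSheafRepresentativesTwAt hTw C m) hDoor hR h₂₁ h₂₂

end Summit.HodgeConjecture.HodgeConjecture.Ring2.SemiregularRepresentatives

end
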